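import Literature.Probability.RandomPlanarGeometry.OneSidedRestrictionFacts
import Literature.Probability.RandomPlanarGeometry.RestrictionLeftFillLaw
import Literature.Analysis.FunctionSpaces.SquaredBesselExistence
import HarnessLib

/-!
# SLE(κ, ρ) ([LSW] §8.3), Lemma 8.3 and Theorem 8.4 as named facts, and [LSW] Cor. 8.6 from them

Level 4 of the decomposition of the named fact
`Literature.Probability.RandomPlanarGeometry.IsRestrictionMeasure.eq_five_eighths_of_simple`
(and of its outer-measure form `…eq_five_eighths_of_outer_simple`; files `RestrictionMeasures`,
plan in `RestrictionMeasuresFiveEighths`, `RestrictionLeftFillLaw`, `OneSidedRestriction(Facts)`),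
after

* G. F. Lawler, O. Schramm, W. Werner, *Conformal restriction: the chordal case*, J. Amer. Math.
  Soc. **16** (2003) 917–955, arXiv:math/0209343 (**[LSW]**, arXiv page numbers as in the sibling files:
  §8.3 "The SLE(κ, ρ) process", Lemma 8.3 (p. 36), Thm. 8.4 (p. 37), Cor. 8.6 (p. 37) and its
  proof (p. 38)).

The tree reduces [LSW] p. 5 result 2 ("the only measure `P_α` that is supported on simple
curves is `P_{5/8}`") to two printed leaves (`IsRestrictionMeasure.eq_five_eighths_of_simple_of_leaves`,
`RestrictionLeftFillLaw`): the interior-point form of Thm. 7.3 (§7, bubbles) and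
`exists_isRightRestrictionMeasure_lt_five_eighths` (`OneSidedRestriction`): "for `0 < α < 5/8`
the right-sided restriction measure `P⁺_α` exists and `P⁺_α{i ∉ K} > 1/2`", which [LSW] obtain
from SLE(8/3, ρ). This file vendors that construction and splits the leaf into the two printed
statements it is made of:

* `Literature.Probability.RandomPlanarGeometry.IsSLEKappaRhoPair κ ρ O W` — **SLE(κ, ρ)** ([LSW] §8.3),
  on the canonical space `(ℝ≥0 → ℝ, preWienerMeasure)` of the tree's Brownian motion `B`
  (`Literature.Probability.Process.brownian`): "One way to construct `(O_t, W_t)` is to first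
  define `Z_t` … More precisely, `Z_t` is `√κ` times a `d`-dimensional Bessel process where
  `d = 1 + 2(ρ + 2)/κ`. … Then, set `O_t = −2 ∫₀ᵗ du/Z_u`, `W_t = Z_t + O_t`." Here the Bessel
  process is the tree's `Literature.Analysis.FunctionSpaces.IsBesselProcess d 0 X B 𝓕 P` (the
  square root of a squared Bessel process `BESQ^d(0)` driven by `B`, Revuz–Yor XI §1), whose
  existence for every real `d` is PROVED in the tree (`exists_isSquaredBesselProcess`), so that
  SLE(κ, ρ) driving pairs exist for all `κ`, `ρ` (`exists_isSLEKappaRhoPair`, proved); the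
  Loewner chain "chordal SLE(κ, ρ)" is the chain of the driving function `t ↦ W_t(ω)`
  (`Loewner.hull`, `LoewnerChain`), `K_∞ = ⋃_t K_t` is `Loewner.hullUnion`, and the random set of
  Thm. 8.4, `K = F^{ℝ₊}_ℍ(cl K_∞)`, is `sleKappaRhoFill W ω`, with the **left filling**
  `F^{ℝ₊}_ℍ(A)` of [LSW] §2 p. 8 ("the union of `A` with the connected components of `ℍ̄ ∖ A`
  which do not intersect `[0, ∞)`") for an ARBITRARY closed `A ⊆ ℍ̄`, `leftFilling A` — it
  extends the tree's `RestrictionConfig.leftFill` (`leftFilling_closure_eq_leftFill`, proved);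
* `Literature.Probability.RandomPlanarGeometry.SLEKappaRho.swallowingTime_ofReal`,
  `….SLEKappaRho.not_isBounded_hullUnion` — NAMED FACTS, **[LSW] Lemma 8.3 (2)–(4)** (p. 36):
  for `κ ≤ 4`, a.s. `K_∞ ∩ ℝ = {0}` if `ρ ≥ ρ₀ = −2 + κ/2` and `K_∞ ∩ ℝ = (−∞, 0]` if `ρ < ρ₀`
  (real points belong to [LSW]'s closed hulls when they are swallowed: stated through the
  tree's `Loewner.swallowingTime` of real points), and `K_∞` is a.s. unbounded (item (1),
  scale invariance in law, is not vendored);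
* `Literature.Probability.RandomPlanarGeometry.SLEKappaRho.isRightRestrictionMeasure_fill` — NAMED FACT, **[LSW]
  Theorem 8.4** (p. 37) in the form in which Cor. 8.5–8.6 use it ("`F^{ℝ₊}_ℍ(K)` has law `P⁺_α`,
  which is described using SLE(8/3, ρ)"): for `ρ > −2` the random set `F^{ℝ₊}_ℍ(cl K_∞)` of
  SLE(8/3, ρ) has a measurable `Ω₊`-valued version whose law is the right-sided restriction
  measure with exponent `α = (3ρ + 10)(2 + ρ)/32` (`IsRightRestrictionMeasure`, §8.1);
  it is unbundled below into `SLEKappaRho.exists_measurable_fill_version` ("`K` is a random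
  element of `Ω₊`": Lemma 8.3 and measurability) and `SLEKappaRho.measure_fill_disjoint` (the
  avoidance formula `P[K ∩ A = ∅] = Φ'_A(0)^α`, `A ∈ 𝒬₊`, computed in §8.4), which are PROVED to
  be jointly equivalent to it (`SLEKappaRho.isRightRestrictionMeasure_fill_of` and converses);
* `Literature.Probability.RandomPlanarGeometry.SLEKappaRho.one_half_lt_measure_I_notMem_fill` — NAMED FACT, the
  first two sentences of the **proof of Cor. 8.6** (p. 38): for `−2 < ρ < 0`, "the probability
  that `i` ends up eventually to 'the right' of the right hand boundary of SLE(8/3, ρ) … is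
  strictly larger than the corresponding quantity for SLE(8/3, 0), which is `1/2` by symmetry",
  i.e. `P{i ∉ F^{ℝ₊}_ℍ(cl K_∞)} > 1/2`.

PROVED here: the elementary algebra of the exponent map `α(ρ) = (3ρ + 10)(2 + ρ)/32` and its
inverse `ρ(α) = (−8 + 2√(24α + 1))/3` (Cor. 8.5: `ρ` spans `(−2, ∞)` as `α` spans `(0, ∞)`,
`ρ(α) < 0 ⟺ α < 5/8`); the assembly of the two vendored leaves of `OneSidedRestrictionFacts`
— [LSW] Prop. 8.1 first sentence (`exists_isRightRestrictionMeasure`, existence of `P⁺_α` for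
all `α > 0`, here from Thm. 8.4: `exists_isRightRestrictionMeasure_of_sleKappaRho`) and the
bundled Cor. 8.6 input `exists_isRightRestrictionMeasure_lt_five_eighths`
(`exists_isRightRestrictionMeasure_lt_five_eighths_of_sleKappaRho`) — hence [LSW] Cor. 8.6
(`not_exists_isRestrictionMeasure_of_lt_five_eighths_of_sleKappaRho`) and p. 5 result 2 in both
readings from Thm. 8.4, the Cor. 8.6 sentence and the §7 leaf
(`IsRestrictionMeasure.eq_five_eighths_of_simple_of_sleKappaRho`).

Design notes. (i) `O_t` is the interval integral `−2 ∫₀ᵗ du/Z_u` literally (Bochner; it is the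
junk value `0` on the null set of paths where `1/Z` is not integrable — [LSW] note
"`∫₀ᵗ du/Z_u = (Z_t − √κ B_t)/(ρ + 2) < ∞`", which is where `ρ > −2`, i.e. `d > 1`, enters; all
statements below are almost sure or in law). (ii) The tree's Loewner hulls are subsets of the
OPEN half-plane (`Loewner.hull W t ⊆ ℍ`); [LSW]'s `K_t ⊆ ℍ̄` also contains the swallowed real
points, which is immaterial for `F^{ℝ₊}_ℍ(cl K_∞)` (the closure and the filling put `(−∞, 0]`
back) and is made explicit in the statement of Lemma 8.3 through swallowing times. (iii) No
choice of a version is made: the facts quantify over all pairs `(O, W)` of the stated form.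

Not vendored: Lemma 8.3 (1) (scale invariance), Cor. 8.5 (the right boundary of `P_α` is the
SLE(8/3, ρ(α)) path), Cor. 8.7, the martingale `M_t` of §8.4, and the fact that SLE(κ, ρ) is
generated by a continuous transient curve (Miller–Sheffield 2016), none of which the assembly
needs.
-/

noncomputable section

open Set Filter Topology MeasureTheory
open UpperHalfPlane (upperHalfPlaneSet)
open scoped NNReal ENNReal
open Literature.Analysis.FunctionSpaces (IsBesselProcess IsSquaredBesselProcess
  exists_isSquaredBesselProcess)
open Literature.Probability.Process (preWienerMeasure brownian)

namespace Literature.Probability.RandomPlanarGeometry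

/-! ### The left filling `F^{ℝ₊}_ℍ(A)` of a subset of the closed half-plane ([LSW] §2 p. 8) -/

/-- **The left filling `F^{ℝ₊}_ℍ(A)`** ([LSW] §2 p. 8, "Fillings"): for closed `A ⊆ ℍ̄`,
"`F^{ℝ₊}_ℍ(A)` denotes the union of `A` with the connected components of `ℍ̄ ∖ A` which do not
intersect `[0, ∞)`." Written as `ℍ̄` minus the components of `ℍ̄ ∖ A` of the points of `[0, ∞)`
(the component of a point of `A` being empty), which makes sense for every `A ⊆ ℂ` and only
depends on `A ∩ ℍ̄`. [cite: LawlerSchrammWerner2003Restriction, §2 p. 8 (Fillings)] -/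
def leftFilling (A : Set ℂ) : Set ℂ :=
  {z : ℂ | 0 ≤ z.im} \ ⋃ x ∈ Ici (0 : ℝ), connectedComponentIn ({z : ℂ | 0 ≤ z.im} \ A) (x : ℂ)

/-- The left filling lies in the closed upper half-plane. [folklore] -/
theorem leftFilling_subset (A : Set ℂ) : leftFilling A ⊆ {z : ℂ | 0 ≤ z.im} :=
  fun _ h ↦ h.1

/-- Membership in the left filling: a point of `ℍ̄` none of whose fellow component members in
`ℍ̄ ∖ A` is a point of `[0, ∞)`. [folklore] -/
theorem mem_leftFilling_iff {A : Set ℂ} {z : ℂ} :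
    z ∈ leftFilling A ↔ 0 ≤ z.im ∧
      ∀ x : ℝ, 0 ≤ x → z ∉ connectedComponentIn ({z : ℂ | 0 ≤ z.im} \ A) (x : ℂ) := by
  simp [leftFilling]

/-- `A ∩ ℍ̄ ⊆ F^{ℝ₊}_ℍ(A)`. [folklore] -/
theorem inter_subset_leftFilling (A : Set ℂ) : A ∩ {z : ℂ | 0 ≤ z.im} ⊆ leftFilling A := by
  rintro z ⟨hzA, hz⟩
  refine mem_leftFilling_iff.2 ⟨hz, fun x _ hzx ↦ ?_⟩
  exact (connectedComponentIn_subset _ _ hzx).2 hzA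

/-- Points of `[0, ∞)` off `A` are not in the left filling. [folklore] -/
theorem ofReal_notMem_leftFilling {A : Set ℂ} {x : ℝ} (hx : 0 ≤ x) (hxA : (x : ℂ) ∉ A) :
    (x : ℂ) ∉ leftFilling A := fun h ↦
  (mem_leftFilling_iff.1 h).2 x hx (mem_connectedComponentIn ⟨by simp, hxA⟩)

/-- The left filling only depends on the trace of the set on `ℍ̄`. [folklore] -/
theorem leftFilling_inter_eq (A : Set ℂ) : leftFilling (A ∩ {z : ℂ | 0 ≤ z.im}) = leftFilling A := by
  have : {z : ℂ | 0 ≤ z.im} \ (A ∩ {z : ℂ | 0 ≤ z.im}) = {z : ℂ | 0 ≤ z.im} \ A := by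
    ext z
    simp only [Set.mem_sdiff, mem_inter_iff, mem_setOf_eq, not_and]
    tauto
  simp only [leftFilling, this]

/-- Components of `ℍ̄ ∖ A`, `A` closed, are relatively open in `ℍ̄`: a point `w` of the
component of `x` has a ball whose trace on `ℍ̄` lies in that component (the trace is convex,
hence connected, and misses `A` for a small radius). [folklore] -/
theorem exists_ball_inter_subset_connectedComponentIn {A : Set ℂ} (hA : IsClosed A) {x w : ℂ}
    (hw : w ∈ connectedComponentIn ({z : ℂ | 0 ≤ z.im} \ A) x) :
    ∃ r > 0, Metric.ball w r ∩ {z : ℂ | 0 ≤ z.im} ⊆ connectedComponentIn ({z : ℂ | 0 ≤ z.im} \ A) x := by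
  have hw' := connectedComponentIn_subset _ _ hw
  obtain ⟨r, hr, hrA⟩ := Metric.isOpen_iff.1 hA.isOpen_compl w hw'.2
  refine ⟨r, hr, ?_⟩
  have hconv : Convex ℝ (Metric.ball w r ∩ {z : ℂ | 0 ≤ z.im}) :=
    (convex_ball w r).inter (convex_halfSpace_im_ge 0)
  have hsub : Metric.ball w r ∩ {z : ℂ | 0 ≤ z.im} ⊆ {z : ℂ | 0 ≤ z.im} \ A :=
    fun z hz ↦ ⟨hz.2, hrA hz.1⟩
  have hwB : w ∈ Metric.ball w r ∩ {z : ℂ | 0 ≤ z.im} := ⟨Metric.mem_ball_self hr, hw'.1⟩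
  rw [connectedComponentIn_eq hw]
  exact hconv.isPreconnected.subset_connectedComponentIn hwB hsub

/-- **`F^{ℝ₊}_ℍ(A)` is closed for closed `A`** (it is `ℍ̄` minus a union of relatively open
subsets of `ℍ̄`). [folklore] -/
theorem isClosed_leftFilling {A : Set ℂ} (hA : IsClosed A) : IsClosed (leftFilling A) := by
  refine isClosed_of_closure_subset fun z hz ↦ ?_
  have hzim : 0 ≤ z.im := by
    have : closure (leftFilling A) ⊆ {z : ℂ | 0 ≤ z.im} :=
      closure_minimal (leftFilling_subset A) (isClosed_le continuous_const Complex.continuous_im)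
    exact this hz
  refine mem_leftFilling_iff.2 ⟨hzim, fun x hx hzx ↦ ?_⟩
  obtain ⟨r, hr, hsub⟩ := exists_ball_inter_subset_connectedComponentIn hA hzx
  -- a point of the filling inside the ball would lie in the component of `x`
  obtain ⟨y, hy, hyz⟩ := Metric.mem_closure_iff.1 hz r hr
  have hyc : y ∈ connectedComponentIn ({z : ℂ | 0 ≤ z.im} \ A) x :=
    hsub ⟨by rwa [Metric.mem_ball, dist_comm], leftFilling_subset A hy⟩
  exact (mem_leftFilling_iff.1 hy).2 x hx hyc

/-- **`leftFilling` extends the tree's `Fill₋(cl K)` for configurations `K ∈ Ω`**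
(`RestrictionConfig.leftFill K = ℍ̄ ∖ rightDomain K`, whose trace on `ℍ̄` is the component of
`1` in `ℍ̄ ∖ cl K`, `RestrictionConfig.rightDomain_inter_eq`): the components in `ℍ̄ ∖ cl K` of
the points of `(0, ∞)` all coincide with that of `1` (the positive axis is connected and misses
`cl K`), and `0 ∈ cl K` has empty component. [cite: LawlerSchrammWerner2003Restriction, §2 p. 8 (Fillings) with §8.1 p. 31] -/
theorem leftFilling_closure_eq_leftFill (K : RestrictionConfig) :
    leftFilling (closure (K : Set ℂ)) = K.leftFill := by
  -- the component of a positive real is the component of `1`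
  have hcomp : ∀ x : ℝ, 0 < x →
      connectedComponentIn ({z : ℂ | 0 ≤ z.im} \ closure (K : Set ℂ)) (x : ℂ) =
        connectedComponentIn ({z : ℂ | 0 ≤ z.im} \ closure (K : Set ℂ)) 1 := by
    intro x hx
    have hx1 : (x : ℂ) ∈ connectedComponentIn ({z : ℂ | 0 ≤ z.im} \ closure (K : Set ℂ)) 1 :=
      K.rightDomain_inter_eq.subset ⟨K.ofReal_mem_rightDomain hx, by simp⟩
    exact (connectedComponentIn_eq hx1).symm
  -- the component of `0 ∈ cl K` is empty
  have hzero : connectedComponentIn ({z : ℂ | 0 ≤ z.im} \ closure (K : Set ℂ)) ((0 : ℝ) : ℂ) = ∅ :=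
    connectedComponentIn_eq_empty fun h ↦ h.2 K.zero_mem_closure
  ext z
  rw [mem_leftFilling_iff, RestrictionConfig.leftFill, Set.mem_sdiff, mem_setOf_eq]
  refine and_congr_right fun hz ↦ ⟨fun h hzR ↦ ?_, fun h x hx hzx ↦ ?_⟩
  · have h1 : z ∈ connectedComponentIn ({z : ℂ | 0 ≤ z.im} \ closure (K : Set ℂ)) 1 :=
      K.rightDomain_inter_eq.subset ⟨hzR, hz⟩
    refine h 1 zero_le_one ?_
    rw [hcomp 1 one_pos]
    exact h1
  · rcases hx.eq_or_lt with rfl | hx'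
    · rw [hzero] at hzx
      exact hzx
    · rw [hcomp x hx'] at hzx
      exact h (K.rightDomain_inter_eq.symm.subset hzx).1

/-! ### SLE(κ, ρ) ([LSW] §8.3) -/

/-- The Bessel dimension of SLE(κ, ρ): `d = 1 + 2(ρ + 2)/κ` ([LSW] §8.3 (8.1): "`Z_t` is `√κ`
times a `d`-dimensional Bessel process where `d = 1 + 2(ρ + 2)/κ`"). [cite: LawlerSchrammWerner2003Restriction, §8.3 (definition of SLE(κ, ρ))] -/
def sleKappaRhoDim (κ : ℝ≥0) (ρ : ℝ) : ℝ := 1 + 2 * (ρ + 2) / κ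

/-- **SLE(κ, ρ) driving pair** ([LSW] §8.3). "Suppose that `κ > 0`, `ρ > −2` and that
`B_t` is a standard one-dimensional Brownian motion. Let `(O_t, W_t)` be the solution of
`dO_t = 2 dt/(O_t − W_t)`, `dW_t = ρ dt/(W_t − O_t) + √κ dB_t` with `O_0 = W_0 = 0` and
`O_t ≤ W_t`. […] One way to construct `(O_t, W_t)` is to first define `Z_t` (later to become
`W_t − O_t`) as the solution to the Bessel equation `dZ_t = (ρ + 2) dt/Z_t + √κ dB_t` started
from `Z_0 = 0`. More precisely, `Z_t` is `√κ` times a `d`-dimensional Bessel process where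
`d = 1 + 2(ρ + 2)/κ`. […] Then, set `O_t = −2 ∫₀ᵗ du/Z_u`, `W_t = Z_t + O_t`." This is that
construction, on the canonical space `(ℝ≥0 → ℝ, preWienerMeasure)`: `(O, W)` (time first, as
all processes of the tree's Itô calculus) is an SLE(κ, ρ) driving pair if for some
`d`-dimensional Bessel process `X` started at `0` and driven by the canonical Brownian motion
(`IsBesselProcess`, the square root of `BESQ^d(0)`, Revuz–Yor XI Def. (1.1), (1.9)),
`Z = √κ X`, `O_t = −2 ∫₀ᵗ du/Z_u` (interval integral; [LSW]: "`∫₀ᵗ du/Z_u =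
(Z_t − √κ B_t)/(ρ + 2) < ∞` for all `t ≥ 0`") and `W = Z + O`. "If we then define the family
of conformal maps `g_t` by `∂_t g_t(z) = 2 (g_t(z) − W_t)⁻¹` […] we get a Loewner chain that
we call chordal SLE(κ, ρ)": the chain of the driving function `t ↦ W t ω` (`Loewner.hull`).
"Note that when `ρ = 0`, we get the ordinary chordal SLE_κ" (then `W = √κ B = sleDriving κ`
almost surely, by the displayed identity; not proved here).
[cite: LawlerSchrammWerner2003Restriction, §8.3 (definition of SLE(κ, ρ))] -/
def IsSLEKappaRhoPair (κ : ℝ≥0) (ρ : ℝ) (O W : ℝ≥0 → (ℝ≥0 → ℝ) → ℝ) : Prop :=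
  ∃ X : ℝ≥0 → (ℝ≥0 → ℝ) → ℝ,
    IsBesselProcess (sleKappaRhoDim κ ρ) 0 X brownian brownianFiltration preWienerMeasure ∧
      (∀ t ω, O t ω = -2 * ∫ u in (0 : ℝ)..(t : ℝ), (Real.sqrt κ * X u.toNNReal ω)⁻¹) ∧
        ∀ t ω, W t ω = Real.sqrt κ * X t ω + O t ω

namespace IsSLEKappaRhoPair

variable {κ : ℝ≥0} {ρ : ℝ} {O W : ℝ≥0 → (ℝ≥0 → ℝ) → ℝ}

/-- `O_t ≤ W_t` (`W − O = Z = √κ X ≥ 0`). [cite: LawlerSchrammWerner2003Restriction, §8.3 (definition of SLE(κ, ρ))] -/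
theorem le (h : IsSLEKappaRhoPair κ ρ O W) (t : ℝ≥0) (ω : ℝ≥0 → ℝ) : O t ω ≤ W t ω := by
  obtain ⟨X, hX, -, hW⟩ := h
  rw [hW t ω]
  exact le_add_of_nonneg_left (mul_nonneg (Real.sqrt_nonneg _) (hX.nonneg t ω))

/-- `O_0 = 0`. [cite: LawlerSchrammWerner2003Restriction, §8.3 (definition of SLE(κ, ρ))] -/
theorem fst_zero (h : IsSLEKappaRhoPair κ ρ O W) (ω : ℝ≥0 → ℝ) : O 0 ω = 0 := by
  obtain ⟨X, -, hO, -⟩ := h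
  simp [hO 0 ω]

/-- `W_0 = 0`. [cite: LawlerSchrammWerner2003Restriction, §8.3 (definition of SLE(κ, ρ))] -/
theorem snd_zero (h : IsSLEKappaRhoPair κ ρ O W) (ω : ℝ≥0 → ℝ) : W 0 ω = 0 := by
  obtain ⟨X, hX, hO, hW⟩ := h
  rw [hW 0 ω, hX.apply_zero ω, hO 0 ω]
  simp

end IsSLEKappaRhoPair

/-- **SLE(κ, ρ) driving pairs exist** for all `κ`, `ρ` (the construction needs a Bessel process
of dimension `d = 1 + 2(ρ + 2)/κ` started at `0`, i.e. the square root of a squared Bessel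
process `BESQ^d(0)`, which exists — as a strong solution driven by the canonical Brownian
motion — for every real `d`: `exists_isSquaredBesselProcess`, proved in the tree; [LSW]: "It is
well-known (e.g., [RY]) that this process is well-defined (for all `ρ > −2` and all `t ≥ 0`)").
[cite: LawlerSchrammWerner2003Restriction, §8.3 (definition of SLE(κ, ρ))] -/
theorem exists_isSLEKappaRhoPair (κ : ℝ≥0) (ρ : ℝ) : ∃ O W, IsSLEKappaRhoPair κ ρ O W := by
  obtain ⟨Z, hZ⟩ := exists_isSquaredBesselProcess (sleKappaRhoDim κ ρ) ((0 : ℝ) ^ 2)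
  set X : ℝ≥0 → (ℝ≥0 → ℝ) → ℝ := fun t ω ↦ Real.sqrt (Z t ω) with hX
  refine ⟨fun t ω ↦ -2 * ∫ u in (0 : ℝ)..(t : ℝ), (Real.sqrt κ * X u.toNNReal ω)⁻¹,
    fun t ω ↦ Real.sqrt κ * X t ω + -2 * ∫ u in (0 : ℝ)..(t : ℝ), (Real.sqrt κ * X u.toNNReal ω)⁻¹,
    X, ⟨Z, hZ, fun t ω ↦ rfl⟩, fun t ω ↦ rfl, fun t ω ↦ rfl⟩

/-- `K_∞ = ⋃_{t ≥ 0} K_t`, the union of the hulls of the Loewner chain driven by `U`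
([LSW] Lemma 8.3: "`K_∞ := ⋃_{t > 0} K_t`"; the tree's hulls are subsets of the open
half-plane). [cite: LawlerSchrammWerner2003Restriction, Lemma 8.3 (p. 36)] -/
def Loewner.hullUnion (U : ℝ≥0 → ℝ) : Set ℂ := ⋃ t, Loewner.hull U t

/-- `K_∞ ⊆ ℍ`. [folklore] -/
theorem Loewner.hullUnion_subset (U : ℝ≥0 → ℝ) : Loewner.hullUnion U ⊆ upperHalfPlaneSet :=
  iUnion_subset fun t ↦ Loewner.hull_subset U t

/-- **The random set of [LSW] Thm. 8.4**, `K = F^{ℝ₊}_ℍ(cl K_∞)`, for a driving process `W`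
(time first) at the sample `ω`: the left filling of the closure of the union of the Loewner
hulls of `t ↦ W t ω`. [cite: LawlerSchrammWerner2003Restriction, Thm. 8.4 (p. 37)] -/
def sleKappaRhoFill (W : ℝ≥0 → (ℝ≥0 → ℝ) → ℝ) (ω : ℝ≥0 → ℝ) : Set ℂ :=
  leftFilling (closure (Loewner.hullUnion fun t ↦ W t ω))

/-- `K ⊆ ℍ̄`. [folklore] -/
theorem sleKappaRhoFill_subset (W : ℝ≥0 → (ℝ≥0 → ℝ) → ℝ) (ω : ℝ≥0 → ℝ) :
    sleKappaRhoFill W ω ⊆ {z : ℂ | 0 ≤ z.im} :=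
  leftFilling_subset _

/-- `K = F^{ℝ₊}_ℍ(cl K_∞)` is closed. [folklore] -/
theorem isClosed_sleKappaRhoFill (W : ℝ≥0 → (ℝ≥0 → ℝ) → ℝ) (ω : ℝ≥0 → ℝ) :
    IsClosed (sleKappaRhoFill W ω) :=
  isClosed_leftFilling isClosed_closure

/-- `cl K_∞ ⊆ K` (the closure of a subset of `ℍ` lies in `ℍ̄`). [folklore] -/
theorem closure_hullUnion_subset_sleKappaRhoFill (W : ℝ≥0 → (ℝ≥0 → ℝ) → ℝ) (ω : ℝ≥0 → ℝ) :
    closure (Loewner.hullUnion fun t ↦ W t ω) ⊆ sleKappaRhoFill W ω := by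
  intro z hz
  refine inter_subset_leftFilling _ ⟨hz, ?_⟩
  have hcl : closure (Loewner.hullUnion fun t ↦ W t ω) ⊆ closure {z : ℂ | 0 ≤ z.im} :=
    closure_mono fun w hw ↦ (show 0 < w.im from Loewner.hullUnion_subset _ hw).le
  rw [(isClosed_le continuous_const Complex.continuous_im).closure_eq] at hcl
  exact hcl hz

/-! ### The exponent `α(ρ)` of Thm. 8.4 and its inverse `ρ(α)` of Cor. 8.5 -/

/-- The exponent of [LSW] Thm. 8.4: `α = (20 + 16ρ + 3ρ²)/32 = (3ρ + 10)(2 + ρ)/32`.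
[cite: LawlerSchrammWerner2003Restriction, Thm. 8.4 (p. 37)] -/
def sleKappaRhoExponent (ρ : ℝ) : ℝ := (3 * ρ + 10) * (2 + ρ) / 32

/-- The inverse map of [LSW] Cor. 8.5: `ρ(α) = (−8 + 2√(24α + 1))/3`.
[cite: LawlerSchrammWerner2003Restriction, Cor. 8.5 (p. 37)] -/
def sleRhoOfExponent (α : ℝ) : ℝ := (-8 + 2 * Real.sqrt (24 * α + 1)) / 3

/-- `α(ρ(α)) = α` (for `α ≥ 0`). [cite: LawlerSchrammWerner2003Restriction, Cor. 8.5 (p. 37)] -/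
theorem sleKappaRhoExponent_sleRhoOfExponent {α : ℝ} (hα : 0 ≤ α) :
    sleKappaRhoExponent (sleRhoOfExponent α) = α := by
  have h1 : (0 : ℝ) ≤ 24 * α + 1 := by positivity
  have hs := Real.sq_sqrt h1
  simp only [sleKappaRhoExponent, sleRhoOfExponent]
  nlinarith [hs]

/-- `ρ(α) > −2` for `α > 0` ("when `ρ` spans `(−2, ∞)`, `α` spans `(0, ∞)`").
[cite: LawlerSchrammWerner2003Restriction, Thm. 8.4 (p. 37)] -/
theorem neg_two_lt_sleRhoOfExponent {α : ℝ} (hα : 0 < α) : -2 < sleRhoOfExponent α := by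
  have h1 : (1 : ℝ) < Real.sqrt (24 * α + 1) := (Real.lt_sqrt zero_le_one).2 (by linarith)
  simp only [sleRhoOfExponent]
  linarith

/-- `ρ(α) < 0` for `α < 5/8` (`ρ(5/8) = 0`). [cite: LawlerSchrammWerner2003Restriction, Cor. 8.5–8.6 (p. 37)] -/
theorem sleRhoOfExponent_neg {α : ℝ} (hlt : α < 5 / 8) : sleRhoOfExponent α < 0 := by
  have h4 : Real.sqrt (24 * α + 1) < 4 := (Real.sqrt_lt' (by norm_num)).2 (by linarith)
  simp only [sleRhoOfExponent]
  linarith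

/-- `ρ(α) > 0` for `α > 5/8`. [cite: LawlerSchrammWerner2003Restriction, Cor. 8.5 (p. 37)] -/
theorem sleRhoOfExponent_pos {α : ℝ} (hlt : 5 / 8 < α) : 0 < sleRhoOfExponent α := by
  have h4 : 4 < Real.sqrt (24 * α + 1) := (Real.lt_sqrt (by norm_num)).2 (by linarith)
  simp only [sleRhoOfExponent]
  linarith

/-- `α(ρ) > 0` for `ρ > −2`. [cite: LawlerSchrammWerner2003Restriction, Thm. 8.4 (p. 37)] -/
theorem sleKappaRhoExponent_pos {ρ : ℝ} (hρ : -2 < ρ) : 0 < sleKappaRhoExponent ρ := by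
  simp only [sleKappaRhoExponent]
  have h1 : 0 < 3 * ρ + 10 := by linarith
  have h2 : 0 < 2 + ρ := by linarith
  positivity

/-- `α(ρ) < 5/8` iff `ρ < 0`, for `ρ > −2`. [cite: LawlerSchrammWerner2003Restriction, Cor. 8.6 (p. 37)] -/
theorem sleKappaRhoExponent_lt_five_eighths_iff {ρ : ℝ} (hρ : -2 < ρ) :
    sleKappaRhoExponent ρ < 5 / 8 ↔ ρ < 0 := by
  simp only [sleKappaRhoExponent]
  constructor
  · intro h
    nlinarith
  · intro h
    nlinarith

/-! ### [LSW] Lemma 8.3 and Theorem 8.4, and the first half of the proof of Cor. 8.6, as named facts -/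

/-- NAMED FACT — **[LSW] Lemma 8.3 (2)–(3)** (p. 36): "Let `κ > 0`, `ρ > −2` and set
`ρ₀ := −2 + κ/2`. Let `K_t` denote the evolving hulls of SLE(κ, ρ) and `K_∞ := ⋃_{t>0} K_t`.
[…] (2) If `κ ≤ 4` and `ρ ≥ ρ₀`, then a.s. `K_∞ ∩ ℝ = {0}`. (3) If `κ ≤ 4` and `ρ < ρ₀`, then
a.s. `K_∞ ∩ ℝ = (−∞, 0]`." [LSW]'s hulls are subsets of `ℍ̄` containing the real points
swallowed by time `t`; with the tree's `Loewner.swallowingTime` of a real point (the lifetime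
of the Loewner flow `ġ = 2/(g − W_t)` on the real line, `LoewnerChain`) the statements read:
a.s., no `x > 0` is ever swallowed, and a negative `x` is never swallowed if `ρ ≥ ρ₀` and is
swallowed in finite time if `ρ < ρ₀` (`0 = W_0` itself does not flow). Proof in [LSW]:
comparison of `g_t(1) − W_t`, `W_t − O_t = Z_t` and `W_t − g_t(−1)` with Bessel processes,
"a.s. the `d`-dimensional Bessel process returns to zero if and only if `d < 2`".
[cite: LawlerSchrammWerner2003Restriction, Lemma 8.3 (2)–(3) (p. 36)] -/
def SLEKappaRho.swallowingTime_ofReal : Prop :=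
  ∀ {κ : ℝ≥0} {ρ : ℝ} {O W : ℝ≥0 → (ℝ≥0 → ℝ) → ℝ}, 0 < κ → κ ≤ 4 → -2 < ρ →
    IsSLEKappaRhoPair κ ρ O W →
      ∀ᵐ ω ∂preWienerMeasure, ∀ x : ℝ,
        (0 < x → Loewner.swallowingTime (fun t ↦ W t ω) x = ⊤) ∧
        (x < 0 → -2 + (κ : ℝ) / 2 ≤ ρ → Loewner.swallowingTime (fun t ↦ W t ω) x = ⊤) ∧
        (x < 0 → ρ < -2 + (κ : ℝ) / 2 → Loewner.swallowingTime (fun t ↦ W t ω) x < ⊤)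

/-- NAMED FACT — **[LSW] Lemma 8.3 (4)** (p. 36): for `κ > 0`, `ρ > −2`, "`K_∞` is a.s.
unbounded" ("Statement 4 easily follows from 1 [scale invariance], for example. One could also
use the fact that the half-plane capacity of `K_t` is `2t`.")
[cite: LawlerSchrammWerner2003Restriction, Lemma 8.3 (4) (p. 36)] -/
def SLEKappaRho.not_isBounded_hullUnion : Prop :=
  ∀ {κ : ℝ≥0} {ρ : ℝ} {O W : ℝ≥0 → (ℝ≥0 → ℝ) → ℝ}, 0 < κ → -2 < ρ →
    IsSLEKappaRhoPair κ ρ O W →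
      ∀ᵐ ω ∂preWienerMeasure, ¬ Bornology.IsBounded (Loewner.hullUnion fun t ↦ W t ω)

/-- NAMED FACT — **[LSW] Theorem 8.4** (p. 37), verbatim: "Let `ρ > −2`, and let
`K = F^{ℝ₊}_ℍ(cl K_∞)`, where `K_t` is the hull of SLE(8/3, ρ) and `K_∞ = ⋃_{t ≥ 0} K_t`. Then
`K` satisfies the right-sided restriction property with exponent
`α = (20 + 16ρ + 3ρ²)/32 = (3ρ + 10)(2 + ρ)/32`." By §8.1 (p. 31) the right-sided restriction
property with exponent `α` is a property of the law of a random element of `Ω₊` and that law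
is then `P⁺_α` (`IsRightRestrictionMeasure α`, unique: `IsRightRestrictionMeasure.unique`); this
is how Cor. 8.5–8.6 use the theorem ("`F^{ℝ₊}_ℍ(K)` has law `P⁺_α`, which is described using
SLE(8/3, ρ)"). Stated accordingly: for every SLE(8/3, ρ) driving pair, the random set
`F^{ℝ₊}_ℍ(cl K_∞)` (`sleKappaRhoFill`) has a version which is a measurable map into `Ω₊` (for
the avoidance σ-field of §8.1) and whose law under the Wiener measure is the right-sided
restriction measure with exponent `α(ρ)`. Implicit printed ingredients of "`K` is a random
element of `Ω₊`": Lemma 8.3 (2)–(4) (`K ∩ ℝ = (−∞, 0]`, `K` unbounded) and the measurability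
of the avoidance events `{K ∩ A = ∅}`, `A ∈ 𝒬₊`. Proof in [LSW] §8.4: for a smooth `A ∈ 𝒬₊`,
`M_t = h_t'(W_t)^{5/8} h_t'(O_t)^b ((h_t(W_t) − h_t(O_t))/(W_t − O_t))^c` is a bounded
martingale with `M_0 = Φ'_A(0)^α` tending to `𝟙{K ∩ A = ∅}`. Not in the tree: SLE(κ, ρ) is
generated by a transient continuous curve, the Itô computation of §8.4, Lemma 2.1 for `𝒬₊`.
[cite: LawlerSchrammWerner2003Restriction, Thm. 8.4 (p. 37) with §8.1 (p. 31) and §8.4] -/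
def SLEKappaRho.isRightRestrictionMeasure_fill : Prop :=
  ∀ {ρ : ℝ} {O W : ℝ≥0 → (ℝ≥0 → ℝ) → ℝ}, -2 < ρ → IsSLEKappaRhoPair (8 / 3) ρ O W →
    ∃ Kc : (ℝ≥0 → ℝ) → RightConfig, Measurable Kc ∧
      (∀ᵐ ω ∂preWienerMeasure, (Kc ω : Set ℂ) = sleKappaRhoFill W ω) ∧
        IsRightRestrictionMeasure (sleKappaRhoExponent ρ) (preWienerMeasure.map Kc)

/-- NAMED FACT — **the asymmetry of SLE(8/3, ρ), `ρ < 0`** (the first two sentences of the proof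
of [LSW] Cor. 8.6, p. 38): "Note that when `ρ < 0`, `W_t − √κ B_t` is decreasing. It follows
easily that the probability that `i` ends up eventually to 'the right' of the right hand
boundary of SLE(8/3, ρ) […] is strictly larger than the corresponding quantity for
SLE(8/3, 0), which is `1/2` by symmetry." Here "`i` to the right of the right hand boundary" is
the event `i ∉ K = F^{ℝ₊}_ℍ(cl K_∞)` (`i` lies in the component of `ℍ̄ ∖ cl K_∞` bordering
`[0, ∞)`), the event whose probability under a two-sided `P_α` the second half of the proof
bounds by `1/2` (`IsRestrictionMeasure.measure_rightOf_I_le_half`, `RestrictionLeftFillLaw`);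
the parenthesis "(i.e., `i` is separated from `1` by `K_∞ ∪ (−∞, 0]`)" of p. 38 names the
complementary side (see the docstring of `exists_isRightRestrictionMeasure_lt_five_eighths`).
For `−2 < ρ < 0` (equivalently `0 < α(ρ) < 5/8`): `P{i ∉ F^{ℝ₊}_ℍ(cl K_∞)} > 1/2`. Not in the
tree: the monotone comparison of the Loewner chains of `W ≤ √κ B`, and `P{i ∉ γ} = 1`,
`P{i right of γ} = 1/2` for the SLE_{8/3} curve `γ`.
[cite: LawlerSchrammWerner2003Restriction, proof of Cor. 8.6 (p. 38), first two sentences] -/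
def SLEKappaRho.one_half_lt_measure_I_notMem_fill : Prop :=
  ∀ {ρ : ℝ} {O W : ℝ≥0 → (ℝ≥0 → ℝ) → ℝ}, -2 < ρ → ρ < 0 → IsSLEKappaRhoPair (8 / 3) ρ O W →
    1 / 2 < preWienerMeasure {ω | Complex.I ∉ sleKappaRhoFill W ω}

/-! ### Assembly: Prop. 8.1 (existence of `P⁺_α`), the Cor. 8.6 input, Cor. 8.6 and p. 5 result 2 -/

/-- **[LSW] Prop. 8.1, first sentence, from Thm. 8.4**: "The right-sided restriction measures
`P⁺_α` exist for all `α > 0`" — `P⁺_α` is the law of `F^{ℝ₊}_ℍ(cl K_∞)` for SLE(8/3, ρ(α)),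
`ρ(α) = (−8 + 2√(24α + 1))/3 > −2` ("when `ρ` spans `(−2, ∞)`, `α` spans `(0, ∞)`"). This
derives the named fact `exists_isRightRestrictionMeasure` (`OneSidedRestrictionFacts`) from
`SLEKappaRho.isRightRestrictionMeasure_fill`.
[cite: LawlerSchrammWerner2003Restriction, Prop. 8.1 (§8.2) via Thm. 8.4 (p. 37)] -/
theorem exists_isRightRestrictionMeasure_of_sleKappaRho
    (h84 : SLEKappaRho.isRightRestrictionMeasure_fill) : exists_isRightRestrictionMeasure := by
  intro α hα
  obtain ⟨O, W, hOW⟩ := exists_isSLEKappaRhoPair (8 / 3) (sleRhoOfExponent α)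
  obtain ⟨Kc, -, -, hQ⟩ := h84 (neg_two_lt_sleRhoOfExponent hα) hOW
  rw [sleKappaRhoExponent_sleRhoOfExponent hα.le] at hQ
  exact ⟨_, hQ⟩

/-- **The Cor. 8.6 input from SLE(8/3, ρ)**: the bundled leaf
`exists_isRightRestrictionMeasure_lt_five_eighths` (`OneSidedRestriction`: for `0 < α < 5/8`,
`P⁺_α` exists and `P⁺_α{i ∉ K} > 1/2`) from Thm. 8.4 (`h84`) and the asymmetry of
SLE(8/3, ρ), `ρ < 0` (`h86`): take `ρ = ρ(α) ∈ (−2, 0)` and `Q` the law of the `Ω₊`-valued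
version `Kc` of `F^{ℝ₊}_ℍ(cl K_∞)`; then `Q = P⁺_α` and
`Q{K : i ∉ K} = P{i ∉ Kc} = P{i ∉ F^{ℝ₊}_ℍ(cl K_∞)} > 1/2`.
[cite: LawlerSchrammWerner2003Restriction, proof of Cor. 8.6 (p. 38) with Thm. 8.4 (p. 37)] -/
theorem exists_isRightRestrictionMeasure_lt_five_eighths_of_sleKappaRho
    (h84 : SLEKappaRho.isRightRestrictionMeasure_fill)
    (h86 : SLEKappaRho.one_half_lt_measure_I_notMem_fill) :
    exists_isRightRestrictionMeasure_lt_five_eighths := by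
  intro α hα hlt
  obtain ⟨O, W, hOW⟩ := exists_isSLEKappaRhoPair (8 / 3) (sleRhoOfExponent α)
  have hρ₁ : -2 < sleRhoOfExponent α := neg_two_lt_sleRhoOfExponent hα
  have hρ₂ : sleRhoOfExponent α < 0 := sleRhoOfExponent_neg hlt
  obtain ⟨Kc, hKc, hae, hQ⟩ := h84 hρ₁ hOW
  have hgt := h86 hρ₁ hρ₂ hOW
  rw [sleKappaRhoExponent_sleRhoOfExponent hα.le] at hQ
  refine ⟨_, hQ, ?_⟩
  have hI : (Complex.I : ℂ) ∈ upperHalfPlaneSet := by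
    show 0 < Complex.I.im
    simp
  rw [Measure.map_apply hKc (RightConfig.measurableSet_notMem hI)]
  have heq : (Kc ⁻¹' {K : RightConfig | Complex.I ∉ (K : Set ℂ)}) =ᵐ[preWienerMeasure]
      {ω | Complex.I ∉ sleKappaRhoFill W ω} :=
    hae.mono fun ω hω ↦ by
      show (Complex.I ∉ (Kc ω : Set ℂ)) = (Complex.I ∉ sleKappaRhoFill W ω)
      rw [hω]
  rwa [measure_congr heq]

/-- **[LSW] Corollary 8.6 from SLE(8/3, ρ)** ("For all `α < 5/8`, the two-sided restriction
probability measure `P_α` does not exist"): the named fact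
`not_exists_isRestrictionMeasure_of_lt_five_eighths` (`RestrictionMeasuresFiveEighths`) from
Thm. 8.4 and the asymmetry sentence, through the proved second half of the proof
(`not_exists_isRestrictionMeasure_of_lt_five_eighths_of_oneSided`, `RestrictionLeftFillLaw`:
`F^{ℝ₊}_ℍ(P_α) = P⁺_α` and `P_α(i right of K) ≤ 1/2` by symmetry).
[cite: LawlerSchrammWerner2003Restriction, Cor. 8.6 (pp. 37–38)] -/
theorem not_exists_isRestrictionMeasure_of_lt_five_eighths_of_sleKappaRho
    (h84 : SLEKappaRho.isRightRestrictionMeasure_fill)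
    (h86 : SLEKappaRho.one_half_lt_measure_I_notMem_fill) :
    not_exists_isRestrictionMeasure_of_lt_five_eighths :=
  not_exists_isRestrictionMeasure_of_lt_five_eighths_of_oneSided
    (exists_isRightRestrictionMeasure_lt_five_eighths_of_sleKappaRho h84 h86)

/-- **[LSW] p. 5 result 2, first sentence, outer reading**
(`IsRestrictionMeasure.eq_five_eighths_of_outer_simple`), from Thm. 8.4 (`h84`), the asymmetry
of SLE(8/3, ρ) for `ρ < 0` (`h86`) and the interior-point form of Thm. 7.3 (`h73`, §7).
[cite: LawlerSchrammWerner2003Restriction, p. 5 result 2; Thm. 7.3, Thm. 8.4, Cor. 8.6] -/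
theorem IsRestrictionMeasure.eq_five_eighths_of_outer_simple_of_sleKappaRho
    (h84 : SLEKappaRho.isRightRestrictionMeasure_fill)
    (h86 : SLEKappaRho.one_half_lt_measure_I_notMem_fill)
    (h73 : IsRestrictionMeasure.ae_interior_nonempty_of_gt_five_eighths) :
    IsRestrictionMeasure.eq_five_eighths_of_outer_simple :=
  IsRestrictionMeasure.eq_five_eighths_of_outer_simple_of_leaves
    (exists_isRightRestrictionMeasure_lt_five_eighths_of_sleKappaRho h84 h86) h73

/-- **[LSW] p. 5 result 2, first sentence, almost-everywhere reading**
(`IsRestrictionMeasure.eq_five_eighths_of_simple`: a two-sided restriction measure `P_α`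
almost every sample of which is a simple curve has `α = 5/8`), from Thm. 8.4 (`h84`), the
asymmetry of SLE(8/3, ρ) for `ρ < 0` (`h86`) and the interior-point form of Thm. 7.3 (`h73`).
[cite: LawlerSchrammWerner2003Restriction, p. 5 result 2; Thm. 7.3, Thm. 8.4, Cor. 8.6] -/
theorem IsRestrictionMeasure.eq_five_eighths_of_simple_of_sleKappaRho
    (h84 : SLEKappaRho.isRightRestrictionMeasure_fill)
    (h86 : SLEKappaRho.one_half_lt_measure_I_notMem_fill)
    (h73 : IsRestrictionMeasure.ae_interior_nonempty_of_gt_five_eighths) :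
    IsRestrictionMeasure.eq_five_eighths_of_simple :=
  IsRestrictionMeasure.eq_five_eighths_of_simple_of_leaves
    (exists_isRightRestrictionMeasure_lt_five_eighths_of_sleKappaRho h84 h86) h73

/-! ### Theorem 8.4 unbundled: "`K` is a random element of `Ω₊`" and the avoidance formula

The law form `SLEKappaRho.isRightRestrictionMeasure_fill` of Thm. 8.4 bundles two statements of
different nature, separated here (and shown to be jointly equivalent to it):
`SLEKappaRho.exists_measurable_fill_version` — the random set `K = F^{ℝ₊}_ℍ(cl K_∞)` of
SLE(8/3, ρ) has an `Ω₊`-valued measurable version (the standing framework of §8.1 in which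
"`K` satisfies the right-sided restriction property" is meaningful: Lemma 8.3 (2)–(4) for
`K ∩ ℝ = (−∞, 0]` and unboundedness, closedness and connectedness of `K` and of `ℍ ∖ K`, and the
measurability of the avoidance events) — and `SLEKappaRho.measure_fill_disjoint` — the formula
`P[K ∩ A = ∅] = Φ'_A(0)^α`, `A ∈ 𝒬₊`, which is what §8.4 computes (`P[K ∩ A = ∅] = M_0`). -/

/-- NAMED FACT — **`K = F^{ℝ₊}_ℍ(cl K_∞)` of SLE(8/3, ρ) is a random element of `Ω₊`** ([LSW]
§8.1 p. 31 with Lemma 8.3 (p. 36) and the statement of Thm. 8.4 (p. 37), which asserts the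
right-sided restriction property — a property of probability measures on `Ω₊` — of the law of
`K`): for `ρ > −2` and every SLE(8/3, ρ) driving pair there is a measurable map `Kc` into `Ω₊`
(avoidance σ-field) with `Kc = F^{ℝ₊}_ℍ(cl K_∞)` almost surely. Printed ingredients: Lemma 8.3
(2)–(4) (`cl K_∞ ∩ (0, ∞) = ∅`, so that `K ∩ ℝ = (−∞, 0]`; `K_∞` unbounded); implicit: `cl K_∞`
is connected and does not accumulate on `(0, ∞)` (SLE(κ, ρ) is generated by a transient
continuous curve), `K` and `ℍ ∖ K` are then closed/connected (cf. `isClosed_leftFilling`,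
`RestrictionSides`), and `{K ∩ A = ∅}` is an event for `A ∈ 𝒬₊`.
[cite: LawlerSchrammWerner2003Restriction, Thm. 8.4 (p. 37) with §8.1 (p. 31) and Lemma 8.3 (p. 36)] -/
def SLEKappaRho.exists_measurable_fill_version : Prop :=
  ∀ {ρ : ℝ} {O W : ℝ≥0 → (ℝ≥0 → ℝ) → ℝ}, -2 < ρ → IsSLEKappaRhoPair (8 / 3) ρ O W →
    ∃ Kc : (ℝ≥0 → ℝ) → RightConfig, Measurable Kc ∧
      ∀ᵐ ω ∂preWienerMeasure, (Kc ω : Set ℂ) = sleKappaRhoFill W ω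

/-- NAMED FACT — **[LSW] Theorem 8.4, the avoidance formula** (p. 37 with §8.1 p. 31: the
right-sided restriction property with exponent `α` means `P[K ∩ A = ∅] = Φ'_A(0)^α` for all
`A ∈ 𝒬₊`; proof in §8.4: "`P[K ∩ A = ∅] = M_0 = Φ'_A(0)^α`" for smooth `A`, then all `A ∈ 𝒬₊`):
for `ρ > −2`, every SLE(8/3, ρ) driving pair, every `A ∈ 𝒬₊` with restriction map `Φ_A` and
`d = Φ'_A(0)`, the Wiener measure of `{K ∩ A = ∅}`, `K = F^{ℝ₊}_ℍ(cl K_∞)`, is `d^α`,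
`α = (3ρ + 10)(2 + ρ)/32` (the measure of the set is meant; it is an event by
`SLEKappaRho.exists_measurable_fill_version`).
[cite: LawlerSchrammWerner2003Restriction, Thm. 8.4 (p. 37) and §8.4] -/
def SLEKappaRho.measure_fill_disjoint : Prop :=
  ∀ {ρ : ℝ} {O W : ℝ≥0 → (ℝ≥0 → ℝ) → ℝ}, -2 < ρ → IsSLEKappaRhoPair (8 / 3) ρ O W →
    ∀ {A : Set ℂ}, IsPlusHull A →
      ∀ {Φ : ConformalEquiv (upperHalfPlaneSet \ A) upperHalfPlaneSet}, IsRestrictionMap A Φ →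
        ∀ {d : ℝ}, HasRestrictionDeriv A Φ d →
          preWienerMeasure {ω | Disjoint (sleKappaRhoFill W ω) A} =
            ENNReal.ofReal (d ^ sleKappaRhoExponent ρ)

/-- The preimage of an avoidance event under a version of `K` is a.e. the avoidance set of `K`.
[folklore] -/
theorem SLEKappaRho.preimage_avoid_ae_eq {W : ℝ≥0 → (ℝ≥0 → ℝ) → ℝ} {Kc : (ℝ≥0 → ℝ) → RightConfig}
    (hae : ∀ᵐ ω ∂preWienerMeasure, (Kc ω : Set ℂ) = sleKappaRhoFill W ω) (A : Set ℂ) :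
    (Kc ⁻¹' RightConfig.avoid A : Set (ℝ≥0 → ℝ)) =ᵐ[preWienerMeasure]
      {ω | Disjoint (sleKappaRhoFill W ω) A} :=
  hae.mono fun ω hω ↦ by
    show (Kc ω ∈ RightConfig.avoid A) = Disjoint (sleKappaRhoFill W ω) A
    rw [RightConfig.mem_avoid, hω]

/-- **Thm. 8.4 in law form from its two halves**: an `Ω₊`-valued version `Kc` of `K`
(`h₁`) and the avoidance formula (`h₂`) give `law(Kc) = P⁺_{α(ρ)}`
(`SLEKappaRho.isRightRestrictionMeasure_fill`). [cite: LawlerSchrammWerner2003Restriction, Thm. 8.4 (p. 37) with §8.1 (p. 31)] -/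
theorem SLEKappaRho.isRightRestrictionMeasure_fill_of
    (h₁ : SLEKappaRho.exists_measurable_fill_version) (h₂ : SLEKappaRho.measure_fill_disjoint) :
    SLEKappaRho.isRightRestrictionMeasure_fill := by
  intro ρ O W hρ hOW
  obtain ⟨Kc, hKc, hae⟩ := h₁ hρ hOW
  haveI : IsProbabilityMeasure preWienerMeasure := isProbabilityMeasure_preWienerMeasure'
  refine ⟨Kc, hKc, hae, Measure.isProbabilityMeasure_map hKc.aemeasurable, ?_⟩
  intro A hA Φ hΦ d hd
  rw [Measure.map_apply hKc (RightConfig.measurableSet_avoid hA),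
    measure_congr (SLEKappaRho.preimage_avoid_ae_eq hae A)]
  exact h₂ hρ hOW hA hΦ hd

/-- Conversely the law form gives the `Ω₊`-valued version … [cite: LawlerSchrammWerner2003Restriction, Thm. 8.4 (p. 37)] -/
theorem SLEKappaRho.exists_measurable_fill_version_of
    (h : SLEKappaRho.isRightRestrictionMeasure_fill) : SLEKappaRho.exists_measurable_fill_version :=
  fun hρ hOW ↦ by
    obtain ⟨Kc, hKc, hae, -⟩ := h hρ hOW
    exact ⟨Kc, hKc, hae⟩

/-- … and the avoidance formula, so that the two halves are jointly equivalent to the law form.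
[cite: LawlerSchrammWerner2003Restriction, Thm. 8.4 (p. 37)] -/
theorem SLEKappaRho.measure_fill_disjoint_of
    (h : SLEKappaRho.isRightRestrictionMeasure_fill) : SLEKappaRho.measure_fill_disjoint := by
  intro ρ O W hρ hOW A hA Φ hΦ d hd
  obtain ⟨Kc, hKc, hae, hQ⟩ := h hρ hOW
  rw [← measure_congr (SLEKappaRho.preimage_avoid_ae_eq hae A),
    ← Measure.map_apply hKc (RightConfig.measurableSet_avoid hA)]
  exact hQ.2 hA hΦ hd

end Literature.Probability.RandomPlanarGeometry

end
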